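import Mathlib
import Summits.ValiantsHypothesis.ValiantsHypothesis.Theses.NewtonUnitEquations
import Summits.ValiantsHypothesis.ValiantsHypothesis.Theorems.NewtonUnitEquationsLogFactorBoundCruxEquiv
import Summits.ValiantsHypothesis.ValiantsHypothesis.Theorems.NewtonUnitEquationsNewtonTauWeakStubProductVertices
import Summits.ValiantsHypothesis.ValiantsHypothesis.Theorems.NewtonUnitEquationsNewtonTauWeakStubVertexCharts
import Summits.ValiantsHypothesis.ValiantsHypothesis.Theorems.NewtonUnitEquationsNewtonTauWeakLevelBound

/-!
# `LogFactorBound` (stmt-ValiantsHypothesis-16048): two regimes where the item is a theorem, uniformly in `k`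

Support file (prover, item stmt-ValiantsHypothesis-16048) for route NewtonUnitEquations; sequel of
`NewtonUnitEquationsLogFactorBoundCruxEquiv.lean` (the item R1
`∃ b, ∀ k m t f, m ≤ ⌊log₂ k⌋ → (t-sparse) → vert (Σ_{i<k} Π_{j<m} f i j) ≤ (k t + 2)^b`
is EQUIVALENT to the crux `NewtonTauWeak`, stmt-ValiantsHypothesis-5904, i.e. to KPTT's weak Newton-polygon
τ-conjecture, open) and of `NewtonUnitEquationsLogFactorBoundNonuniform.lean` (R1 holds for each fixed `t` and
each fixed `m`; its content is the uniformity of `b`).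

The judged difficulty of R1 is `k`-UNIFORMITY (`k ≥ 2^m` products).  This file certifies the two classical
regimes in which a bound of the item's shape holds with `b = 2`, uniformly in `k` (and says precisely what a
counterexample must therefore do):

* §1–§2 (geometry) `extremePoints_convexHull_iUnion_subset`, `convexHull_extremePoints_eq` (Minkowski for
  finite sets, from Mathlib's Krein–Milman) and the **vertex-survival lemma** `vert_sum_le_of_vertices_mem`:
  if every monomial of every summand `P i` that is a vertex of `Newt(P i)` survives in `Σ_i P i`, then
  `Newt(Σ_i P i) = conv(⋃_i Newt(P i))` and `vert (Σ_i P i) ≤ Σ_i vert (P i)` — a sum gains vertices beyond its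
  summands' ONLY by cancelling a vertex monomial of a summand (whose coefficient, for a product of sparse
  polynomials, is a single product of coefficients: the route's "unit equation");
* §3–§4 with the tree's Ostrowski count `vert (Π_{j<m} g j) ≤ 2 m t + 2` (`stub_productVertices` fed with the
  proved `stub_vertexCharts`): **KPTT's no-cancellation bound for general `k`**,
  `vert (Σ_{i<k} Π_{j<m} f i j) ≤ k (2 m t + 2)` as soon as no product loses a hull-vertex monomial
  (`vert_sum_prod_le_of_vertices_mem`, `vert_sum_prod_le_of_support_subset`);
* §5 the **monotone case**: nonnegative real coefficients never cancel (`ComplexOrder`), so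
  `vert ≤ k (2 m t + 2)` (`vert_sum_prod_le_of_nonneg`), and in the regime `m ≤ ⌊log₂ k⌋` (where `2 m ≤ k`)
  the item's literal bound holds with `b = 2`: `logFactorBound_of_nonneg`;
* §6 the **bounded-width case** (the tree's level bound `vert ≤ 2·#levels`, for general `Σ^k Π^m`): if all
  exponents of all factors have levels `a e₀ + b e₁` in a common window of width `W` for some `(a, b) ∈ ℤ² ∖ 0`,
  then `vert ≤ 2 (m W + 1)` uniformly in `k` AND `t` (`vert_sum_prod_le_of_levels`), hence the item with `b = 2`
  whenever `W ≤ k t + 1` (`logFactorBound_of_levels`).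

So a counterexample to R1 (equivalently to KPTT's weak conjecture) must, at once, cancel hull-vertex monomials
of products and have lattice width `> k t + 1` in every lattice direction (digit-type frames).
No definitions, no named facts, no `sorry`.  [KPTT arXiv:1308.2286 §2 ("if there are no cancellations … at
most `kmt` edges"); Ostrowski; folklore]
-/

set_option linter.dupNamespace false

namespace Summit.ValiantsHypothesis.ValiantsHypothesis.Theorems.NewtonUnitEquationsLogFactorBound

open scoped BigOperators
open MvPolynomial
open Summit.ValiantsHypothesis.ValiantsHypothesis.Theorems.NewtonTauWeak.Negative
  (vert vert_le_card_support vert_sum_fin_zero vert_sum_fin_zero')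
open Summit.ValiantsHypothesis.ValiantsHypothesis.Theorems.NewtonUnitEquationsNewtonTauWeak
  (stub_productVertices stub_vertexCharts vert_le_two_mul_card_levels)

/-! ## §1 Geometry: the hull of a union has no extreme point that is not extreme in a piece -/

/-- Extreme points of `conv(⋃ S_i)` are extreme points of some `conv(S_i)`. [folklore] -/
theorem extremePoints_convexHull_iUnion_subset {E ι : Type*} [AddCommGroup E] [Module ℝ E]
    (S : ι → Set E) :
    (convexHull ℝ (⋃ i, S i)).extremePoints ℝ ⊆ ⋃ i, (convexHull ℝ (S i)).extremePoints ℝ := by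
  intro x hx
  obtain ⟨i, hi⟩ := Set.mem_iUnion.mp (extremePoints_convexHull_subset hx)
  exact Set.mem_iUnion.mpr ⟨i, inter_extremePoints_subset_extremePoints_of_subset
    (convexHull_mono (Set.subset_iUnion S i)) ⟨subset_convexHull ℝ _ hi, hx⟩⟩

/-- Counting form: `#ext conv(⋃_{i} S_i) ≤ Σ_i #ext conv(S_i)` for finitely many finite sets. [folklore] -/
theorem ncard_extremePoints_convexHull_iUnion_le {E ι : Type*} [AddCommGroup E] [Module ℝ E] [Fintype ι]
    (S : ι → Set E) (hS : ∀ i, (S i).Finite) :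
    ((convexHull ℝ (⋃ i, S i)).extremePoints ℝ).ncard ≤
      ∑ i, ((convexHull ℝ (S i)).extremePoints ℝ).ncard := by
  have hfin : (⋃ i, (convexHull ℝ (S i)).extremePoints ℝ).Finite :=
    Set.finite_iUnion fun i => (hS i).subset extremePoints_convexHull_subset
  exact (Set.ncard_le_ncard (extremePoints_convexHull_iUnion_subset S) hfin).trans
    (Set.ncard_iUnion_le_of_fintype _)

/-- **Minkowski for finite sets** (from Krein–Milman): the hull of a finite set is the hull of its
extreme points. [folklore] -/
theorem convexHull_extremePoints_eq {E : Type*} [NormedAddCommGroup E] [NormedSpace ℝ E] {S : Set E}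
    (hS : S.Finite) : convexHull ℝ ((convexHull ℝ S).extremePoints ℝ) = convexHull ℝ S := by
  have hfin : ((convexHull ℝ S).extremePoints ℝ).Finite := hS.subset extremePoints_convexHull_subset
  rw [← (hfin.isClosed_convexHull (𝕜 := ℝ)).closure_eq]
  exact closure_convexHull_extremePoints (hS.isCompact_convexHull (𝕜 := ℝ)) (convex_convexHull ℝ S)

/-! ## §2 Sums: only a cancelled VERTEX of a summand can create new vertices -/

/-- **Vertex survival ⇒ no amplification.**  If every monomial of every summand `P i` that is a vertex of
`Newt(P i)` survives in the sum `Σ_i P i`, then `Newt(Σ_i P i) = conv(⋃_i Newt(P i))`, whence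
`vert (Σ_i P_i) ≤ Σ_i vert (P_i)`: a sum of polynomials acquires vertices beyond those of its summands only by
cancelling a vertex monomial of some summand. [folklore; KPTT arXiv:1308.2286 §2] -/
theorem vert_sum_le_of_vertices_mem {k : ℕ} (P : Fin k → MvPolynomial (Fin 2) ℂ)
    (hv : ∀ i, ∀ e ∈ (P i).support,
      (fun l : Fin 2 => ((e l : ℕ) : ℝ)) ∈ (convexHull ℝ ((fun e : Fin 2 →₀ ℕ => fun l : Fin 2 => ((e l : ℕ) : ℝ)) ''
        ((P i).support : Set (Fin 2 →₀ ℕ)))).extremePoints ℝ → e ∈ (∑ i, P i).support) :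
    vert (∑ i, P i) ≤ ∑ i, vert (P i) := by
  classical
  set emb : (Fin 2 →₀ ℕ) → (Fin 2 → ℝ) := fun e l => ((e l : ℕ) : ℝ) with hemb
  set S : Set (Fin 2 → ℝ) := emb '' ((∑ i, P i).support : Set (Fin 2 →₀ ℕ)) with hSdef
  set U : Fin k → Set (Fin 2 → ℝ) := fun i => emb '' ((P i).support : Set (Fin 2 →₀ ℕ)) with hUdef
  have hSU : S ⊆ ⋃ i, U i := by
    rintro _ ⟨e, he, rfl⟩
    obtain ⟨i, -, hi⟩ := Finset.mem_biUnion.mp (MvPolynomial.support_sum (Finset.mem_coe.mp he))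
    exact Set.mem_iUnion.mpr ⟨i, e, Finset.mem_coe.mpr hi, rfl⟩
  have hUS : ∀ i, convexHull ℝ (U i) ⊆ convexHull ℝ S := by
    intro i
    rw [← convexHull_extremePoints_eq (((P i).support.finite_toSet).image emb)]
    refine convexHull_mono ?_
    intro x hx
    obtain ⟨e, he, rfl⟩ := extremePoints_convexHull_subset hx
    exact ⟨e, Finset.mem_coe.mpr (hv i e (Finset.mem_coe.mp he) hx), rfl⟩
  have heq : convexHull ℝ S = convexHull ℝ (⋃ i, U i) :=
    Set.Subset.antisymm (convexHull_mono hSU)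
      (convexHull_min (Set.iUnion_subset fun i => (subset_convexHull ℝ _).trans (hUS i))
        (convex_convexHull ℝ S))
  show ((convexHull ℝ S).extremePoints ℝ).ncard ≤ ∑ i, ((convexHull ℝ (U i)).extremePoints ℝ).ncard
  rw [heq]
  exact ncard_extremePoints_convexHull_iUnion_le U fun i => ((P i).support.finite_toSet).image emb

/-- **No cancellation ⇒ no amplification** (special case: every monomial of every summand survives). [folklore] -/
theorem vert_sum_le_of_support_subset {k : ℕ} (P : Fin k → MvPolynomial (Fin 2) ℂ)
    (hcf : ∀ i, (P i).support ⊆ (∑ i, P i).support) :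
    vert (∑ i, P i) ≤ ∑ i, vert (P i) :=
  vert_sum_le_of_vertices_mem P fun i _ he _ => hcf i he

/-! ## §3 Products (Ostrowski, from the tree) -/

/-- A product of `m` `t`-sparse bivariate polynomials has at most `2mt + 2` Newton vertices
(the tree's `stub_productVertices` fed with the proved `stub_vertexCharts`). [KPTT arXiv:1308.2286 §2; Ostrowski] -/
theorem vert_prod_le (m t : ℕ) (g : Fin m → MvPolynomial (Fin 2) ℂ) (hg : ∀ j, (g j).support.card ≤ t) :
    vert (∏ j, g j) ≤ 2 * m * t + 2 :=
  stub_productVertices stub_vertexCharts m t g hg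

/-! ## §4 Cancellation-free sums of products: the no-cancellation bound `k (2mt + 2)` -/

/-- **Vertex-survival form of KPTT's no-cancellation count.**  If no monomial of a product `Π_j f i j` that is
a vertex of ITS OWN Newton polygon is cancelled in the sum, then `vert (Σ_{i<k} Π_{j<m} f i j) ≤ k (2 m t + 2)`:
a counterexample to the item must cancel hull vertices of products, not merely interior monomials.
[folklore; KPTT arXiv:1308.2286 §2] -/
theorem vert_sum_prod_le_of_vertices_mem (k m t : ℕ) (f : Fin k → Fin m → MvPolynomial (Fin 2) ℂ)
    (hf : ∀ i j, (f i j).support.card ≤ t)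
    (hv : ∀ i, ∀ e ∈ (∏ j, f i j).support,
      (fun l : Fin 2 => ((e l : ℕ) : ℝ)) ∈ (convexHull ℝ ((fun e : Fin 2 →₀ ℕ => fun l : Fin 2 => ((e l : ℕ) : ℝ)) ''
        ((∏ j, f i j).support : Set (Fin 2 →₀ ℕ)))).extremePoints ℝ → e ∈ (∑ i, ∏ j, f i j).support) :
    vert (∑ i, ∏ j, f i j) ≤ k * (2 * m * t + 2) :=
  calc vert (∑ i, ∏ j, f i j) ≤ ∑ i, vert (∏ j, f i j) := vert_sum_le_of_vertices_mem _ hv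
    _ ≤ ∑ _i : Fin k, (2 * m * t + 2) := Finset.sum_le_sum fun i _ => vert_prod_le m t (f i) (hf i)
    _ = k * (2 * m * t + 2) := by simp

/-- **KPTT's no-cancellation count, general `k`.**  If no monomial of any product `Π_j f i j` is cancelled in
the sum, then `vert (Σ_{i<k} Π_{j<m} f i j) ≤ k (2 m t + 2)`. [KPTT arXiv:1308.2286 §2] -/
theorem vert_sum_prod_le_of_support_subset (k m t : ℕ) (f : Fin k → Fin m → MvPolynomial (Fin 2) ℂ)
    (hf : ∀ i j, (f i j).support.card ≤ t)
    (hcf : ∀ i, (∏ j, f i j).support ⊆ (∑ i, ∏ j, f i j).support) :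
    vert (∑ i, ∏ j, f i j) ≤ k * (2 * m * t + 2) :=
  calc vert (∑ i, ∏ j, f i j) ≤ ∑ i, vert (∏ j, f i j) := vert_sum_le_of_support_subset _ hcf
    _ ≤ ∑ _i : Fin k, (2 * m * t + 2) := Finset.sum_le_sum fun i _ => vert_prod_le m t (f i) (hf i)
    _ = k * (2 * m * t + 2) := by simp

/-! ## §5 The monotone case: nonnegative real coefficients never cancel -/

section Monotone

open scoped ComplexOrder

/-- Products of polynomials with nonnegative real coefficients have nonnegative real coefficients. [folklore] -/
theorem coeff_mul_nonneg {p q : MvPolynomial (Fin 2) ℂ} (hp : ∀ e, 0 ≤ p.coeff e) (hq : ∀ e, 0 ≤ q.coeff e)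
    (e : Fin 2 →₀ ℕ) : 0 ≤ (p * q).coeff e := by
  rw [coeff_mul]
  exact Finset.sum_nonneg fun x _ => mul_nonneg (hp x.1) (hq x.2)

/-- Finite products of polynomials with nonnegative real coefficients have nonnegative real coefficients. [folklore] -/
theorem coeff_prod_nonneg {m : ℕ} (g : Fin m → MvPolynomial (Fin 2) ℂ) (hg : ∀ j e, 0 ≤ (g j).coeff e)
    (e : Fin 2 →₀ ℕ) : 0 ≤ (∏ j, g j).coeff e := by
  classical
  suffices h : ∀ (s : Finset (Fin m)) (e : Fin 2 →₀ ℕ), 0 ≤ (∏ j ∈ s, g j).coeff e from h _ e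
  intro s
  induction s using Finset.induction_on with
  | empty =>
      intro e
      rw [Finset.prod_empty, ← C_1, coeff_C]
      split_ifs
      · exact zero_le_one
      · exact le_rfl
  | insert a s ha ih =>
      intro e
      rw [Finset.prod_insert ha]
      exact coeff_mul_nonneg (hg a) ih e

/-- In a sum of polynomials with nonnegative real coefficients no monomial cancels. [folklore] -/
theorem support_subset_support_sum_of_nonneg {k : ℕ} (P : Fin k → MvPolynomial (Fin 2) ℂ)
    (hP : ∀ i e, 0 ≤ (P i).coeff e) (i : Fin k) : (P i).support ⊆ (∑ i, P i).support := by
  intro e he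
  rw [mem_support_iff] at he ⊢
  have hpos : 0 < (P i).coeff e := lt_of_le_of_ne (hP i e) (Ne.symm he)
  have hle : (P i).coeff e ≤ (∑ i, P i).coeff e := by
    rw [coeff_sum]
    exact Finset.single_le_sum (fun j _ => hP j e) (Finset.mem_univ i)
  exact (lt_of_lt_of_le hpos hle).ne'

/-- **The monotone case of the no-cancellation bound.**  If every coefficient of every `f i j` is a
nonnegative real, then `vert (Σ_{i<k} Π_{j<m} f i j) ≤ k (2 m t + 2)`. [KPTT arXiv:1308.2286 §2] -/
theorem vert_sum_prod_le_of_nonneg (k m t : ℕ) (f : Fin k → Fin m → MvPolynomial (Fin 2) ℂ)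
    (hf : ∀ i j, (f i j).support.card ≤ t)
    (hpos : ∀ i j e, 0 ≤ ((f i j).coeff e).re ∧ ((f i j).coeff e).im = 0) :
    vert (∑ i, ∏ j, f i j) ≤ k * (2 * m * t + 2) := by
  have h0 : ∀ i j e, (0 : ℂ) ≤ (f i j).coeff e := fun i j e =>
    Complex.nonneg_iff.mpr ⟨(hpos i j e).1, (hpos i j e).2.symm⟩
  exact vert_sum_prod_le_of_support_subset k m t f hf
    (support_subset_support_sum_of_nonneg (fun i => ∏ j, f i j) (fun i => coeff_prod_nonneg (f i) (h0 i)))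

end Monotone

/-- In the regime R1 (`m ≤ ⌊log₂ k⌋`, `k ≥ 1`) one has `2 m ≤ 2^m ≤ k`. [folklore] -/
theorem two_mul_le_of_le_log {k m : ℕ} (hk : 0 < k) (hm : m ≤ Nat.log 2 k) : 2 * m ≤ k := by
  have h2 : 2 * m ≤ 2 ^ m := by
    cases m with
    | zero => simp
    | succ d =>
        calc 2 * (d + 1) ≤ 2 * 2 ^ d := Nat.mul_le_mul_left 2 (Nat.succ_le_of_lt d.lt_two_pow_self)
          _ = 2 ^ (d + 1) := by ring
  calc 2 * m ≤ 2 ^ m := h2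
    _ ≤ 2 ^ Nat.log 2 k := Nat.pow_le_pow_right (by norm_num) hm
    _ ≤ k := Nat.pow_log_le_self 2 hk.ne'

/-- **`LogFactorBound` holds, with `b = 2`, on monotone families.**  The literal signature of
stmt-ValiantsHypothesis-16048 restricted to `f i j` with nonnegative real coefficients: in the regime
`m ≤ ⌊log₂ k⌋` one has `2m ≤ k`, so `k (2mt + 2) ≤ (k t + 2)^2` (corner `t = 0`: the sum is `0` or the constant `k`).
So every counterexample to the item must cancel monomials between products. [KPTT arXiv:1308.2286 §2] -/
theorem logFactorBound_of_nonneg (k m t : ℕ) (f : Fin k → Fin m → MvPolynomial (Fin 2) ℂ)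
    (hm : m ≤ Nat.log 2 k) (hf : ∀ i j, (f i j).support.card ≤ t)
    (hpos : ∀ i j e, 0 ≤ ((f i j).coeff e).re ∧ ((f i j).coeff e).im = 0) :
    (Set.extremePoints ℝ (convexHull ℝ ((fun e : Fin 2 →₀ ℕ => fun i : Fin 2 => ((e i : ℕ) : ℝ)) ''
      ((∑ i, ∏ j, f i j).support : Set (Fin 2 →₀ ℕ))))).ncard ≤ (k * t + 2) ^ 2 := by
  show vert (∑ i, ∏ j, f i j) ≤ (k * t + 2) ^ 2
  rcases Nat.eq_zero_or_pos m with rfl | hmpos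
  · calc vert (∑ i, ∏ j, f i j) ≤ 1 := vert_sum_fin_zero' k f
      _ ≤ (k * t + 2) ^ 2 := Nat.one_le_pow _ _ (by omega)
  rcases Nat.eq_zero_or_pos t with rfl | htpos
  · rw [sum_prod_eq_zero_of_sparsity_zero k m hmpos f hf, vert_zero]
    exact Nat.zero_le _
  have hkpos : 0 < k := by
    rcases Nat.eq_zero_or_pos k with rfl | hk
    · simp at hm; omega
    · exact hk
  have h2m : 2 * m ≤ k := two_mul_le_of_le_log hkpos hm
  have hA : 2 * m * (k * t) ≤ k * (k * t) := Nat.mul_le_mul_right _ h2m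
  have hB : k * (k * t) ≤ (k * t) * (k * t) := Nat.mul_le_mul_right _ (Nat.le_mul_of_pos_right k htpos)
  have hC : 2 * k ≤ 4 * (k * t) := by
    have : k ≤ k * t := Nat.le_mul_of_pos_right k htpos
    omega
  calc vert (∑ i, ∏ j, f i j) ≤ k * (2 * m * t + 2) := vert_sum_prod_le_of_nonneg k m t f hf hpos
    _ = 2 * m * (k * t) + 2 * k := by ring
    _ ≤ (k * t) * (k * t) + 4 * (k * t) + 4 := by omega
    _ = (k * t + 2) ^ 2 := by ring

/-! ## §6 The bounded-width case: the level bound, general `Σ^k Π^m` form -/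

/-- **Level bound for sums of products.**  If, for some nonzero integer functional `ℓ = (a, b)`, every exponent
of every factor has its level in a common window `[L, L + W]`, then every exponent of `Σ_{i<k} Π_{j<m} f i j` has
level in `[m L, m L + m W]`, so `vert ≤ 2 (m W + 1)` — uniformly in `k` AND `t`. [folklore; level bound of the tree] -/
theorem vert_sum_prod_le_of_levels (k m : ℕ) (f : Fin k → Fin m → MvPolynomial (Fin 2) ℂ)
    {a b : ℤ} (hab : a ≠ 0 ∨ b ≠ 0) (L : ℤ) (W : ℕ)
    (hW : ∀ i j, ∀ e ∈ (f i j).support, L ≤ a * (e 0 : ℤ) + b * (e 1 : ℤ) ∧ a * (e 0 : ℤ) + b * (e 1 : ℤ) ≤ L + W) :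
    vert (∑ i, ∏ j, f i j) ≤ 2 * (m * W + 1) := by
  classical
  set ℓ : (Fin 2 →₀ ℕ) → ℤ := fun e => a * (e 0 : ℤ) + b * (e 1 : ℤ) with hℓ
  have hℓadd : ∀ x y : Fin 2 →₀ ℕ, ℓ (x + y) = ℓ x + ℓ y := by
    intro x y
    simp only [hℓ, Finsupp.coe_add, Pi.add_apply, Nat.cast_add]
    ring
  -- levels of a product of `s.card` factors lie in `[|s| L, |s| L + |s| W]`
  have hprod : ∀ (i : Fin k) (s : Finset (Fin m)), ∀ e ∈ (∏ j ∈ s, f i j).support,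
      (s.card : ℤ) * L ≤ ℓ e ∧ ℓ e ≤ (s.card : ℤ) * L + (s.card : ℤ) * W := by
    intro i s
    induction s using Finset.induction_on with
    | empty =>
        intro e he
        rw [Finset.prod_empty] at he
        have h1 : e ∈ ({0} : Finset (Fin 2 →₀ ℕ)) := by
          rw [← C_1, ← monomial_zero'] at he
          exact support_monomial_subset he
        rw [Finset.mem_singleton] at h1
        subst h1
        simp [hℓ]
    | insert j s hj ih =>
        intro e he
        rw [Finset.prod_insert hj] at he
        obtain ⟨x, hx, y, hy, rfl⟩ : ∃ x ∈ (f i j).support, ∃ y ∈ (∏ j ∈ s, f i j).support, x + y = e := by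
          have h := support_mul _ _ he
          rw [Finset.mem_add] at h
          exact h
        have h1 := hW i j x hx
        have h2 := ih y hy
        rw [hℓadd, Finset.card_insert_of_notMem hj]
        push_cast
        constructor <;> nlinarith [h1.1, h1.2, h2.1, h2.2]
  -- hence the levels of the sum lie in an integer interval with `m W + 1` points
  have hlev : ((∑ i, ∏ j, f i j).support.image ℓ) ⊆ Finset.Icc ((m : ℤ) * L) ((m : ℤ) * L + (m : ℤ) * W) := by
    intro v hv
    obtain ⟨e, he, rfl⟩ := Finset.mem_image.mp hv
    obtain ⟨i, -, hi⟩ := Finset.mem_biUnion.mp (MvPolynomial.support_sum he)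
    have h := hprod i Finset.univ e hi
    rw [Finset.card_univ, Fintype.card_fin] at h
    exact Finset.mem_Icc.mpr h
  calc vert (∑ i, ∏ j, f i j) ≤ 2 * ((∑ i, ∏ j, f i j).support.image ℓ).card :=
        vert_le_two_mul_card_levels _ hab
    _ ≤ 2 * (Finset.Icc ((m : ℤ) * L) ((m : ℤ) * L + (m : ℤ) * W)).card :=
        Nat.mul_le_mul_left _ (Finset.card_le_card hlev)
    _ = 2 * (m * W + 1) := by
        rw [Int.card_Icc]
        congr 1
        have : (m : ℤ) * L + (m : ℤ) * W + 1 - (m : ℤ) * L = ((m * W + 1 : ℕ) : ℤ) := by push_cast; ring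
        rw [this, Int.toNat_natCast]

/-- **`LogFactorBound` holds, with `b = 2`, on families of bounded lattice width.**  The literal signature of
stmt-ValiantsHypothesis-16048 restricted to factors whose exponents have levels in a common window of width
`W ≤ k t + 1` for some nonzero integer functional: then `vert ≤ 2 (m W + 1) ≤ (k t + 2)^2` since `2 m ≤ k`
in the regime `m ≤ ⌊log₂ k⌋`.  So every counterexample to the item needs lattice width exceeding `k t + 1` in
EVERY lattice direction (e.g. digit frames). [folklore] -/
theorem logFactorBound_of_levels (k m t : ℕ) (f : Fin k → Fin m → MvPolynomial (Fin 2) ℂ)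
    (hm : m ≤ Nat.log 2 k) (hf : ∀ i j, (f i j).support.card ≤ t)
    {a b : ℤ} (hab : a ≠ 0 ∨ b ≠ 0) (L : ℤ) (W : ℕ) (hWk : W ≤ k * t + 1)
    (hW : ∀ i j, ∀ e ∈ (f i j).support, L ≤ a * (e 0 : ℤ) + b * (e 1 : ℤ) ∧ a * (e 0 : ℤ) + b * (e 1 : ℤ) ≤ L + W) :
    (Set.extremePoints ℝ (convexHull ℝ ((fun e : Fin 2 →₀ ℕ => fun i : Fin 2 => ((e i : ℕ) : ℝ)) ''
      ((∑ i, ∏ j, f i j).support : Set (Fin 2 →₀ ℕ))))).ncard ≤ (k * t + 2) ^ 2 := by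
  show vert (∑ i, ∏ j, f i j) ≤ (k * t + 2) ^ 2
  rcases Nat.eq_zero_or_pos m with rfl | hmpos
  · calc vert (∑ i, ∏ j, f i j) ≤ 1 := vert_sum_fin_zero' k f
      _ ≤ (k * t + 2) ^ 2 := Nat.one_le_pow _ _ (by omega)
  rcases Nat.eq_zero_or_pos t with rfl | htpos
  · rw [sum_prod_eq_zero_of_sparsity_zero k m hmpos f hf, vert_zero]
    exact Nat.zero_le _
  rcases Nat.eq_zero_or_pos k with rfl | hkpos
  · rw [vert_sum_fin_zero]; exact Nat.zero_le _
  have h2m : 2 * m ≤ k := two_mul_le_of_le_log hkpos hm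
  have hA : 2 * m * W ≤ k * W := Nat.mul_le_mul_right _ h2m
  have hB : k * W ≤ k * (k * t + 1) := Nat.mul_le_mul_left _ hWk
  have hC : k ≤ k * t := Nat.le_mul_of_pos_right k htpos
  have hD : k * (k * t) ≤ (k * t) * (k * t) := Nat.mul_le_mul_right _ hC
  calc vert (∑ i, ∏ j, f i j) ≤ 2 * (m * W + 1) := vert_sum_prod_le_of_levels k m f hab L W hW
    _ = 2 * m * W + 2 := by ring
    _ ≤ k * (k * t + 1) + 2 := by omega
    _ = k * (k * t) + k + 2 := by ring
    _ ≤ (k * t) * (k * t) + 4 * (k * t) + 4 := by omega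
    _ = (k * t + 2) ^ 2 := by ring

end Summit.ValiantsHypothesis.ValiantsHypothesis.Theorems.NewtonUnitEquationsLogFactorBound
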